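import Summits.HodgeConjecture.HodgeConjecture.Theorems.NikulinTwinTransportSquareGlueKunneth
import Literature.AlgebraicGeometry.HodgeTheory.GysinBaseChange
import Literature.AlgebraicGeometry.HodgeTheory.ComplexGysinCorrespondence
import HarnessLib

/-!
# Ring 2 · sub-cell AbelianAll (ALL ABELIAN VARIETIES), André axis, part XLV-a — THE CORRESPONDENCE ACTION IS FAITHFUL:
# a class `c ∈ H^{2e}((Y × Z)(ℂ); ℂ)` is determined by its actions `[c]_* : Hᵃ(Z) → Hᵇ(Y)` in all (typed) degrees

HONEST FRAMING (page 1, verbatim): **research route, not a corollary; conditional on HC_CM plus one named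
minimal statement.** Cell line: research route conditional on HC_CM; not a corollary; Q11.4-sentence-2
already refuted in dim ≥ 3. Nothing in this file proves a case of the Hodge conjecture or of `B`; `HC_CM`
(`Theses.RankFourFaces.CMAbelianHodge`) does NOT occur; item `Theses.RankFourFaces.CMToAbelian` (stmt-16267) stays OPEN; N104 untouched;
no node is born (0 `def`). Seat `pub-hodge-ring2-ab-andre-2`, gen 37. General tool for part XLV (the restricted class AS A CLASS).

## Why

Parts XL–XLIV of this axis test an algebraic class `γ` of the `(2d+2)`-fold `𝒳 × 𝒳` (a compact pencil `f : 𝒳 ⟶ S` of abelian `d`-folds)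
through the ACTION of its restriction `(j_t × j_t)^* γ` on `H•(X_t)` — the fibre trace `j_t^* [γ]_* j_{t*} = K · [(j_t × j_t)^* γ]_*`
(part XLIV-b). To speak of the restricted class ITSELF (part XLV-b: it is algebraic on `X_t × X_t` by the tree's PROVED Fulton pull-back,
determined by the fibre traces, the same for all β-witnesses) one needs that a class on a product is determined by its correspondence
actions. In print this is the identification `H•(Y × Z) = Hom(H•(Z), H•(Y))` of a Weil cohomology (Künneth + Poincaré duality;
Kleiman 1968 §1.3, Fulton §16.1): folklore, absent from the tree, whose `IsAlgebraicCorrespondence` is a one-degree predicate.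

## What is proved (sorry-free, standard axioms; no definition, no named fact)

* §1 **`eq_zero_of_corrAction_eq_zero_allDegrees`** — for smooth projective `Y`, `Z` (dimensions `m`, `n`), an orientation family `μ` and
  `c ∈ H^{2e}((Y ⊗ Z)(ℂ); ℂ)`: if `[c]_* = pr_{Y*}(pr_Z^*(·) ∪ c) : Hᵃ(Z(ℂ)) → Hᵇ(Y(ℂ))` vanishes in every typed degree
  (`a + 2e = b + 2n`, `a ≤ 2n`, `b ≤ 2m`), then `c = 0`. Proof: `⟨c ∪ (pr_Y^* b ∪ pr_Z^* w), [Y × Z]⟩ = ± ⟨[c]_* w ∪ b, [Y]⟩`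
  (`Gysin = transpose of pull-back`, the tree's `NikulinTwinTransport.cupPairing_corrFst_eq`), the cross products span (the tree's
  `kunnethSpan_complexBetti`), and the cup-product pairing of the closed oriented manifold `(Y ⊗ Z)(ℂ)` is perfect
  (`NikulinTwinTransport.eq_zero_of_forall_cupPairing_cross_eq_zero`).
* §2 **`eq_of_corrAction_eq_allDegrees`** (two classes with the same actions are equal), **`self_eq_of_corrAction_eq_allDegrees`** (the
  degree-`0` self-correspondence form used on a `d`-fold `X`: classes in `H^{2d}((X ⊗ X)(ℂ))` with the same action on every `Hᵏ(X(ℂ))`,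
  `k ≤ 2d`, are equal), `corrAction_self_injective`.

## Honest status

FOLKLORE in print (Kleiman 1968 §1.3; Fulton 1998 §16.1; Voisin II §9.2). The tree already has the DEGREE-ZERO case (classes in
`H^{2 dim X}((W ⊗ X)(ℂ))`, actions `Hᵃ → Hᵃ`): `Ring2.Hypotheses.eq_of_forall_corrAction_eq` (file `Ring2HypothesesDescentAbsoluteExteriorGraphClasses`)
and `Theorems.eq_zero_of_forall_corrAction_eq_zero` (file `Ring2HypothesesDescentMotivatedTraceFormulaPairing`), both with heavy import
closures; THIS file gives the general codimension `e` (actions `Hᵃ(Z) → Hᵇ(Y)`, `a + 2e = b + 2 dim Z`, needed for the degree-`−2`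
self-correspondences `H^{k+2}(𝒳) → Hᵏ(𝒳)` of the André axis) with the light imports of part XLIV, and re-derives the degree-`0` form from it.
Consumer: part XLV-b/c. Nothing minimal is claimed; N104 untouched. EDGE LABELS: all K (no binder).
References: Kleiman1968AlgebraicCycles (§1.3); Fulton1998 (§16.1 Def. 16.1.1–2); VoisinHodgeII2003 (§9.2.4, proof of Thm. 10.17 (10.7));
HatcherAT2002 (§3.2 Thm. 3.15, §3.3 Prop. 3.38); FultonYoungTableaux1997 (App. B §B.1 (5)).
-/

noncomputable section

set_option linter.dupNamespace false

namespace Summit.HodgeConjecture.HodgeConjecture.Ring2.AbelianAll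

open CategoryTheory AlgebraicGeometry MonoidalCategory CartesianMonoidalCategory
open Literature.AlgebraicGeometry Literature.AlgebraicGeometry.Motives
open Literature.AlgebraicGeometry.HodgeTheory
open Literature.AlgebraicTopology.SingularHomology (singularCohomology cupProduct cupPairing)
open Summit.HodgeConjecture.HodgeConjecture.Theorems.NikulinTwinTransport (eq_zero_of_forall_cupPairing_cross_eq_zero
  cupPairing_corrFst_eq)

variable (μ : OrientationFamily) {m n : ℕ} {Y Z : SchemeOver ℂ}

/-! ## §1 A class acting as zero in every degree is zero -/

/-- **THE CORRESPONDENCE ACTION IS FAITHFUL.** Let `Y`, `Z` be smooth projective of dimensions `m`, `n`, `μ` an orientation family and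
`c ∈ H^{2e}((Y ⊗ Z)(ℂ); ℂ)`. If the correspondence action `[c]_* = pr_{Y*}(pr_Z^*(·) ∪ c) : Hᵃ(Z(ℂ); ℂ) → Hᵇ(Y(ℂ); ℂ)` (`corrAction μ`)
vanishes in every typed degree `a + 2e = b + 2n` with `a ≤ 2n`, `b ≤ 2m`, then `c = 0`. Indeed `c` pairs to zero with every cross
product `pr_Y^* b ∪ pr_Z^* w`: for `deg b ≤ 2m` the pairing is `± ⟨[c]_* w ∪ b, [Y(ℂ)]⟩` (Gysin is the transpose of pull-back), and
`Hⁱ(Y(ℂ)) = 0` for `i > 2m`; the cross products span `H•((Y ⊗ Z)(ℂ))` (Künneth) and the cup-product pairing of `(Y ⊗ Z)(ℂ)` is perfect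
(Poincaré duality). [cite: Kleiman1968AlgebraicCycles, §1.3] [cite: Fulton1998, §16.1 Def. 16.1.1 and Def. 16.1.2]
[cite: HatcherAT2002, §3.2 Thm. 3.15 and §3.3 Prop. 3.38] -/
theorem eq_zero_of_corrAction_eq_zero_allDegrees (hY : IsSmoothProjective m Y) (hZ : IsSmoothProjective n Z) {e : ℕ}
    {c : complexBetti (Y ⊗ Z) (2 * e)}
    (h : ∀ ⦃a b : ℕ⦄ (hab : a + 2 * e = b + 2 * n), a ≤ 2 * n → b ≤ 2 * m → corrAction μ hY hZ hab c = 0) :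
    c = 0 := by
  have hYZ := IsSmoothProjective.tensor_holds hY hZ
  rcases lt_or_ge (2 * (m + n)) (2 * e) with he | he
  · haveI := subsingleton_complexBetti hYZ he
    exact Subsingleton.elim _ _
  obtain ⟨l, hkl⟩ : ∃ l : ℕ, 2 * e + l = 2 * (m + n) := ⟨2 * (m + n) - 2 * e, by omega⟩
  refine eq_zero_of_forall_cupPairing_cross_eq_zero μ hY hZ hkl (fun z ↦ kunnethSpan_complexBetti hY hZ l z)
    fun i j hij b w ↦ ?_
  rcases lt_or_ge (2 * m) i with hi | hi
  · -- `Hⁱ(Y(ℂ)) = 0`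
    haveI := subsingleton_complexBetti hY hi
    rw [Subsingleton.elim b 0, map_zero, map_zero, LinearMap.zero_apply, map_zero]
  rcases lt_or_ge (2 * n) j with hj | hj
  · -- `Hʲ(Z(ℂ)) = 0`
    haveI := subsingleton_complexBetti hZ hj
    rw [Subsingleton.elim w 0, map_zero, map_zero, map_zero]
  -- the typed case: `⟨c ∪ (pr_Y^* b ∪ pr_Z^* w), [Y ⊗ Z]⟩ = ± ⟨[c]_* w ∪ b, [Y]⟩ = 0`
  obtain ⟨i', hi'⟩ : ∃ i' : ℕ, i' + i = 2 * m := ⟨2 * m - i, by omega⟩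
  have hab : j + 2 * e = i' + 2 * n := by omega
  have key := cupPairing_corrFst_eq μ hY hZ hkl hij (rfl : j + 2 * e = j + 2 * e) (corrAction_degree m hab) hi' c b w
  have hzero : cupPairing (μ hY) hi' (corrAction μ hY hZ hab c w) b = 0 := by
    rw [h hab hj (by omega), LinearMap.zero_apply, map_zero, LinearMap.zero_apply]
  rw [corrAction_apply] at hzero
  rw [hzero] at key
  have hsign : ((-1 : ℂ) ^ (j * (2 * e) + j * i)) ≠ 0 := pow_ne_zero _ (neg_ne_zero.2 one_ne_zero)
  exact (mul_eq_zero.1 key.symm).resolve_left hsign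

/-! ## §2 Classes with the same actions are equal -/

/-- **Two classes on `Y × Z` with the same correspondence action in every typed degree are equal** (§1 applied to the difference).
[cite: Kleiman1968AlgebraicCycles, §1.3] [cite: Fulton1998, §16.1 Def. 16.1.2] -/
theorem eq_of_corrAction_eq_allDegrees (hY : IsSmoothProjective m Y) (hZ : IsSmoothProjective n Z) {e : ℕ}
    {c₁ c₂ : complexBetti (Y ⊗ Z) (2 * e)}
    (h : ∀ ⦃a b : ℕ⦄ (hab : a + 2 * e = b + 2 * n), a ≤ 2 * n → b ≤ 2 * m →
      corrAction μ hY hZ hab c₁ = corrAction μ hY hZ hab c₂) :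
    c₁ = c₂ := by
  rw [← sub_eq_zero]
  refine eq_zero_of_corrAction_eq_zero_allDegrees μ hY hZ fun a b hab ha hb ↦ ?_
  rw [map_sub, h hab ha hb, sub_self]

variable {d : ℕ} {X : SchemeOver ℂ}

/-- **Degree-zero self-correspondences of a `d`-fold are determined by their actions**: two classes `γ₁, γ₂ ∈ H^{2d}((X ⊗ X)(ℂ); ℂ)`
(`X` smooth projective of dimension `d`) whose actions `[γᵢ]_* : Hᵏ(X(ℂ)) → Hᵏ(X(ℂ))` agree for every `k ≤ 2d` are equal — the form
used for the restricted classes `(j_t × j_t)^* γ` on the square of a fibre (parts XLIV-b, XLV-b).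
[cite: Kleiman1968AlgebraicCycles, §1.3] [cite: VoisinHodgeII2003, proof of Thm. 10.17 (10.7)] -/
theorem self_eq_of_corrAction_eq_allDegrees (hX : IsSmoothProjective d X) {γ₁ γ₂ : complexBetti (X ⊗ X) (2 * d)}
    (h : ∀ k : ℕ, k ≤ 2 * d →
      corrAction μ hX hX (rfl : k + 2 * d = k + 2 * d) γ₁ = corrAction μ hX hX (rfl : k + 2 * d = k + 2 * d) γ₂) :
    γ₁ = γ₂ := by
  refine eq_of_corrAction_eq_allDegrees μ hX hX fun a b hab ha _ ↦ ?_
  obtain rfl : a = b := by omega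
  exact h a ha

/-- The same, pointwise: if `[γ₁]_* x = [γ₂]_* x` for every `k ≤ 2d` and every `x ∈ Hᵏ(X(ℂ); ℂ)`, then `γ₁ = γ₂`.
[cite: Kleiman1968AlgebraicCycles, §1.3] -/
theorem self_eq_of_corrAction_apply_eq_allDegrees (hX : IsSmoothProjective d X) {γ₁ γ₂ : complexBetti (X ⊗ X) (2 * d)}
    (h : ∀ (k : ℕ), k ≤ 2 * d → ∀ x : complexBetti X k,
      corrAction μ hX hX (rfl : k + 2 * d = k + 2 * d) γ₁ x = corrAction μ hX hX (rfl : k + 2 * d = k + 2 * d) γ₂ x) :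
    γ₁ = γ₂ :=
  self_eq_of_corrAction_eq_allDegrees μ hX fun k hk ↦ LinearMap.ext (h k hk)

/-- **`γ ↦ ([γ]_* on Hᵏ(X(ℂ)))_{k ≤ 2d}` is injective** on `H^{2d}((X ⊗ X)(ℂ); ℂ)`: the linear map to `Π_{k ≤ 2d} End(Hᵏ(X(ℂ)))`
has trivial kernel. [cite: Kleiman1968AlgebraicCycles, §1.3] [cite: Fulton1998, §16.1 Def. 16.1.2] -/
theorem corrAction_self_injective (hX : IsSmoothProjective d X) :
    Function.Injective fun γ : complexBetti (X ⊗ X) (2 * d) ↦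
      fun k : Fin (2 * d + 1) ↦ corrAction μ hX hX (rfl : (k : ℕ) + 2 * d = (k : ℕ) + 2 * d) γ := by
  intro γ₁ γ₂ h
  refine self_eq_of_corrAction_eq_allDegrees μ hX fun k hk ↦ ?_
  have := congr_fun h ⟨k, by omega⟩
  exact this

end Summit.HodgeConjecture.HodgeConjecture.Ring2.AbelianAll

end
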